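import Literature.Algebra.Polynomial.CasasAlvero.Degree9CharP
import Literature.Algebra.Polynomial.CasasAlvero.Degree10CharP
import HarnessLib

/-!
# More bad primes: `CA_9` and `CA_10` fail in characteristic 19

Explicit prime-field-rational Casas-Alvero polynomials in the depressed normal forms `nf9`, `nf10` of this directory,
found by random sampling of the normal form over `F_p` (`dgen/rsearch.py` of the seat-2 g4 packet; a hit = an `f` whose Hasse
derivatives `H_1 f, …, H_{d-1} f` each vanish at an `F_p`-rational root of `f`): `(p, d) = (19, 9)` (2 hits in 3.0·10^6 samples),
`(19, 10)` (1 hit in 2.1·10^6).  Each refutes `CA_d` over EVERY field of that characteristic; these bad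
primes lie beyond the published tables (degrees `≤ 7`) of [CastryckLaterveerOunaies2012, §2].  [folklore]
-/

noncomputable section

open Polynomial

namespace Literature.Algebra.Polynomial.CasasAlvero

variable (K : Type*) [Field K]

section Char19
variable [CharP K 19]

/-- `X^9 + (3) X^7 + (-3) X^6 + (9) X^5 + (-7) X^3 + (5) X^1` is Casas-Alvero in characteristic 19 (witness roots H1↦5, H2↦0, H3↦-7, H4↦0, H5↦-7, H6↦5, H7↦-7, H8↦0). [folklore] -/
theorem isCasasAlvero_nf9_char_19 : IsCasasAlvero (nf9 K (3) (-3) (9) (0) (-7) (0) (5)) := by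
  have hp : (19 : K) = 0 := by simpa using CharP.cast_eq_zero K 19
  intro i hi0 hi
  rw [natDegree_nf9] at hi
  unfold nf9
  interval_cases i
  · refine ⟨(5 : K), ?_, ?_⟩
    · simp only [eval_add, eval_pow, eval_X, eval_smul, smul_eq_mul]
      linear_combination (114100 : K) * hp
    · simp only [map_add, map_smul, hasseDeriv_X_pow, eval_add, eval_mul, eval_C, eval_pow, eval_X, eval_smul, smul_eq_mul,
        show Nat.choose 9 1 = 9 from rfl, show Nat.choose 7 1 = 7 from rfl, show Nat.choose 6 1 = 6 from rfl, show Nat.choose 5 1 = 5 from rfl, show Nat.choose 4 1 = 4 from rfl, show Nat.choose 3 1 = 3 from rfl, show Nat.choose 2 1 = 2 from rfl, show Nat.choose 1 1 = 1 from rfl]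
      push_cast
      linear_combination (200795 : K) * hp
  · refine ⟨(0 : K), ?_, ?_⟩
    · simp only [eval_add, eval_pow, eval_X, eval_smul, smul_eq_mul]
      linear_combination (0 : K) * hp
    · simp only [map_add, map_smul, hasseDeriv_X_pow, eval_add, eval_mul, eval_C, eval_pow, eval_X, eval_smul, smul_eq_mul,
        show Nat.choose 9 2 = 36 from rfl, show Nat.choose 7 2 = 21 from rfl, show Nat.choose 6 2 = 15 from rfl, show Nat.choose 5 2 = 10 from rfl, show Nat.choose 4 2 = 6 from rfl, show Nat.choose 3 2 = 3 from rfl, show Nat.choose 2 2 = 1 from rfl, show Nat.choose 1 2 = 0 from rfl]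
      push_cast
      linear_combination (0 : K) * hp
  · refine ⟨(-7 : K), ?_, ?_⟩
    · simp only [eval_add, eval_pow, eval_X, eval_smul, smul_eq_mul]
      linear_combination (-2280320 : K) * hp
    · simp only [map_add, map_smul, hasseDeriv_X_pow, eval_add, eval_mul, eval_C, eval_pow, eval_X, eval_smul, smul_eq_mul,
        show Nat.choose 9 3 = 84 from rfl, show Nat.choose 7 3 = 35 from rfl, show Nat.choose 6 3 = 20 from rfl, show Nat.choose 5 3 = 10 from rfl, show Nat.choose 4 3 = 4 from rfl, show Nat.choose 3 3 = 1 from rfl, show Nat.choose 2 3 = 0 from rfl, show Nat.choose 1 3 = 0 from rfl]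
      push_cast
      linear_combination (534716 : K) * hp
  · refine ⟨(0 : K), ?_, ?_⟩
    · simp only [eval_add, eval_pow, eval_X, eval_smul, smul_eq_mul]
      linear_combination (0 : K) * hp
    · simp only [map_add, map_smul, hasseDeriv_X_pow, eval_add, eval_mul, eval_C, eval_pow, eval_X, eval_smul, smul_eq_mul,
        show Nat.choose 9 4 = 126 from rfl, show Nat.choose 7 4 = 35 from rfl, show Nat.choose 6 4 = 15 from rfl, show Nat.choose 5 4 = 5 from rfl, show Nat.choose 4 4 = 1 from rfl, show Nat.choose 3 4 = 0 from rfl, show Nat.choose 2 4 = 0 from rfl, show Nat.choose 1 4 = 0 from rfl]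
      push_cast
      linear_combination (0 : K) * hp
  · refine ⟨(-7 : K), ?_, ?_⟩
    · simp only [eval_add, eval_pow, eval_X, eval_smul, smul_eq_mul]
      linear_combination (-2280320 : K) * hp
    · simp only [map_add, map_smul, hasseDeriv_X_pow, eval_add, eval_mul, eval_C, eval_pow, eval_X, eval_smul, smul_eq_mul,
        show Nat.choose 9 5 = 126 from rfl, show Nat.choose 7 5 = 21 from rfl, show Nat.choose 6 5 = 6 from rfl, show Nat.choose 5 5 = 1 from rfl, show Nat.choose 4 5 = 0 from rfl, show Nat.choose 3 5 = 0 from rfl, show Nat.choose 2 5 = 0 from rfl, show Nat.choose 1 5 = 0 from rfl]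
      push_cast
      linear_combination (16092 : K) * hp
  · refine ⟨(5 : K), ?_, ?_⟩
    · simp only [eval_add, eval_pow, eval_X, eval_smul, smul_eq_mul]
      linear_combination (114100 : K) * hp
    · simp only [map_add, map_smul, hasseDeriv_X_pow, eval_add, eval_mul, eval_C, eval_pow, eval_X, eval_smul, smul_eq_mul,
        show Nat.choose 9 6 = 84 from rfl, show Nat.choose 7 6 = 7 from rfl, show Nat.choose 6 6 = 1 from rfl, show Nat.choose 5 6 = 0 from rfl, show Nat.choose 4 6 = 0 from rfl, show Nat.choose 3 6 = 0 from rfl, show Nat.choose 2 6 = 0 from rfl, show Nat.choose 1 6 = 0 from rfl]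
      push_cast
      linear_combination (558 : K) * hp
  · refine ⟨(-7 : K), ?_, ?_⟩
    · simp only [eval_add, eval_pow, eval_X, eval_smul, smul_eq_mul]
      linear_combination (-2280320 : K) * hp
    · simp only [map_add, map_smul, hasseDeriv_X_pow, eval_add, eval_mul, eval_C, eval_pow, eval_X, eval_smul, smul_eq_mul,
        show Nat.choose 9 7 = 36 from rfl, show Nat.choose 7 7 = 1 from rfl, show Nat.choose 6 7 = 0 from rfl, show Nat.choose 5 7 = 0 from rfl, show Nat.choose 4 7 = 0 from rfl, show Nat.choose 3 7 = 0 from rfl, show Nat.choose 2 7 = 0 from rfl, show Nat.choose 1 7 = 0 from rfl]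
      push_cast
      linear_combination (93 : K) * hp
  · refine ⟨(0 : K), ?_, ?_⟩
    · simp only [eval_add, eval_pow, eval_X, eval_smul, smul_eq_mul]
      linear_combination (0 : K) * hp
    · simp only [map_add, map_smul, hasseDeriv_X_pow, eval_add, eval_mul, eval_C, eval_pow, eval_X, eval_smul, smul_eq_mul,
        show Nat.choose 9 8 = 9 from rfl, show Nat.choose 7 8 = 0 from rfl, show Nat.choose 6 8 = 0 from rfl, show Nat.choose 5 8 = 0 from rfl, show Nat.choose 4 8 = 0 from rfl, show Nat.choose 3 8 = 0 from rfl, show Nat.choose 2 8 = 0 from rfl, show Nat.choose 1 8 = 0 from rfl]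
      push_cast
      linear_combination (0 : K) * hp

end Char19

/-- `CA_9` FAILS over every field of characteristic `19`. [folklore] -/
theorem not_holdsInDegree_nine_of_char_19 [CharP K 19] : ¬ HoldsInDegree K 9 := by
  have hq : (19 : K) = 0 := by simpa using CharP.cast_eq_zero K 19
  exact not_holdsInDegree_nine_of_nf9 K (isCasasAlvero_nf9_char_19 K)
    (fun h => one_ne_zero (by linear_combination (-8 : K) * h - (-3 : K) * hq : (1 : K) = 0))

section Char19Deg10
variable [CharP K 19]

/-- `X^10 + (-7) X^8 + (5) X^6 + (-9) X^5 + (-1) X^4 + (9) X^3 + (8) X^2 + (6) X^1` is Casas-Alvero in characteristic 19 (witness roots H1↦8, H2↦8, H3↦-1, H4↦8, H5↦-2, H6↦-1, H7↦0, H8↦-1, H9↦0). [folklore] -/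
theorem isCasasAlvero_nf10_char_19 : IsCasasAlvero (nf10 K (-7) (0) (5) (-9) (-1) (9) (8) (6)) := by
  have hp : (19 : K) = 0 := by simpa using CharP.cast_eq_zero K 19
  intro i hi0 hi
  rw [natDegree_nf10] at hi
  unfold nf10
  interval_cases i
  · refine ⟨(8 : K), ?_, ?_⟩
    · simp only [eval_add, eval_pow, eval_X, eval_smul, smul_eq_mul]
      linear_combination (50385168 : K) * hp
    · simp only [map_add, map_smul, hasseDeriv_X_pow, eval_add, eval_mul, eval_C, eval_pow, eval_X, eval_smul, smul_eq_mul,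
        show Nat.choose 10 1 = 10 from rfl, show Nat.choose 8 1 = 8 from rfl, show Nat.choose 7 1 = 7 from rfl, show Nat.choose 6 1 = 6 from rfl, show Nat.choose 5 1 = 5 from rfl, show Nat.choose 4 1 = 4 from rfl, show Nat.choose 3 1 = 3 from rfl, show Nat.choose 2 1 = 2 from rfl, show Nat.choose 1 1 = 1 from rfl]
      push_cast
      linear_combination (64501858 : K) * hp
  · refine ⟨(8 : K), ?_, ?_⟩
    · simp only [eval_add, eval_pow, eval_X, eval_smul, smul_eq_mul]
      linear_combination (50385168 : K) * hp
    · simp only [map_add, map_smul, hasseDeriv_X_pow, eval_add, eval_mul, eval_C, eval_pow, eval_X, eval_smul, smul_eq_mul,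
        show Nat.choose 10 2 = 45 from rfl, show Nat.choose 8 2 = 28 from rfl, show Nat.choose 7 2 = 21 from rfl, show Nat.choose 6 2 = 15 from rfl, show Nat.choose 5 2 = 10 from rfl, show Nat.choose 4 2 = 6 from rfl, show Nat.choose 3 2 = 3 from rfl, show Nat.choose 2 2 = 1 from rfl, show Nat.choose 1 2 = 0 from rfl]
      push_cast
      linear_combination (37045024 : K) * hp
  · refine ⟨(-1 : K), ?_, ?_⟩
    · simp only [eval_add, eval_pow, eval_X, eval_smul, smul_eq_mul]
      linear_combination (0 : K) * hp
    · simp only [map_add, map_smul, hasseDeriv_X_pow, eval_add, eval_mul, eval_C, eval_pow, eval_X, eval_smul, smul_eq_mul,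
        show Nat.choose 10 3 = 120 from rfl, show Nat.choose 8 3 = 56 from rfl, show Nat.choose 7 3 = 35 from rfl, show Nat.choose 6 3 = 20 from rfl, show Nat.choose 5 3 = 10 from rfl, show Nat.choose 4 3 = 4 from rfl, show Nat.choose 3 3 = 1 from rfl, show Nat.choose 2 3 = 0 from rfl, show Nat.choose 1 3 = 0 from rfl]
      push_cast
      linear_combination (5 : K) * hp
  · refine ⟨(8 : K), ?_, ?_⟩
    · simp only [eval_add, eval_pow, eval_X, eval_smul, smul_eq_mul]
      linear_combination (50385168 : K) * hp
    · simp only [map_add, map_smul, hasseDeriv_X_pow, eval_add, eval_mul, eval_C, eval_pow, eval_X, eval_smul, smul_eq_mul,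
        show Nat.choose 10 4 = 210 from rfl, show Nat.choose 8 4 = 70 from rfl, show Nat.choose 7 4 = 35 from rfl, show Nat.choose 6 4 = 15 from rfl, show Nat.choose 5 4 = 5 from rfl, show Nat.choose 4 4 = 1 from rfl, show Nat.choose 3 4 = 0 from rfl, show Nat.choose 2 4 = 0 from rfl, show Nat.choose 1 4 = 0 from rfl]
      push_cast
      linear_combination (2791981 : K) * hp
  · refine ⟨(-2 : K), ?_, ?_⟩
    · simp only [eval_add, eval_pow, eval_X, eval_smul, smul_eq_mul]
      linear_combination (-12 : K) * hp
    · simp only [map_add, map_smul, hasseDeriv_X_pow, eval_add, eval_mul, eval_C, eval_pow, eval_X, eval_smul, smul_eq_mul,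
        show Nat.choose 10 5 = 252 from rfl, show Nat.choose 8 5 = 56 from rfl, show Nat.choose 7 5 = 21 from rfl, show Nat.choose 6 5 = 6 from rfl, show Nat.choose 5 5 = 1 from rfl, show Nat.choose 4 5 = 0 from rfl, show Nat.choose 3 5 = 0 from rfl, show Nat.choose 2 5 = 0 from rfl, show Nat.choose 1 5 = 0 from rfl]
      push_cast
      linear_combination (-263 : K) * hp
  · refine ⟨(-1 : K), ?_, ?_⟩
    · simp only [eval_add, eval_pow, eval_X, eval_smul, smul_eq_mul]
      linear_combination (0 : K) * hp
    · simp only [map_add, map_smul, hasseDeriv_X_pow, eval_add, eval_mul, eval_C, eval_pow, eval_X, eval_smul, smul_eq_mul,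
        show Nat.choose 10 6 = 210 from rfl, show Nat.choose 8 6 = 28 from rfl, show Nat.choose 7 6 = 7 from rfl, show Nat.choose 6 6 = 1 from rfl, show Nat.choose 5 6 = 0 from rfl, show Nat.choose 4 6 = 0 from rfl, show Nat.choose 3 6 = 0 from rfl, show Nat.choose 2 6 = 0 from rfl, show Nat.choose 1 6 = 0 from rfl]
      push_cast
      linear_combination (1 : K) * hp
  · refine ⟨(0 : K), ?_, ?_⟩
    · simp only [eval_add, eval_pow, eval_X, eval_smul, smul_eq_mul]
      linear_combination (0 : K) * hp
    · simp only [map_add, map_smul, hasseDeriv_X_pow, eval_add, eval_mul, eval_C, eval_pow, eval_X, eval_smul, smul_eq_mul,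
        show Nat.choose 10 7 = 120 from rfl, show Nat.choose 8 7 = 8 from rfl, show Nat.choose 7 7 = 1 from rfl, show Nat.choose 6 7 = 0 from rfl, show Nat.choose 5 7 = 0 from rfl, show Nat.choose 4 7 = 0 from rfl, show Nat.choose 3 7 = 0 from rfl, show Nat.choose 2 7 = 0 from rfl, show Nat.choose 1 7 = 0 from rfl]
      push_cast
      linear_combination (0 : K) * hp
  · refine ⟨(-1 : K), ?_, ?_⟩
    · simp only [eval_add, eval_pow, eval_X, eval_smul, smul_eq_mul]
      linear_combination (0 : K) * hp
    · simp only [map_add, map_smul, hasseDeriv_X_pow, eval_add, eval_mul, eval_C, eval_pow, eval_X, eval_smul, smul_eq_mul,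
        show Nat.choose 10 8 = 45 from rfl, show Nat.choose 8 8 = 1 from rfl, show Nat.choose 7 8 = 0 from rfl, show Nat.choose 6 8 = 0 from rfl, show Nat.choose 5 8 = 0 from rfl, show Nat.choose 4 8 = 0 from rfl, show Nat.choose 3 8 = 0 from rfl, show Nat.choose 2 8 = 0 from rfl, show Nat.choose 1 8 = 0 from rfl]
      push_cast
      linear_combination (2 : K) * hp
  · refine ⟨(0 : K), ?_, ?_⟩
    · simp only [eval_add, eval_pow, eval_X, eval_smul, smul_eq_mul]
      linear_combination (0 : K) * hp
    · simp only [map_add, map_smul, hasseDeriv_X_pow, eval_add, eval_mul, eval_C, eval_pow, eval_X, eval_smul, smul_eq_mul,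
        show Nat.choose 10 9 = 10 from rfl, show Nat.choose 8 9 = 0 from rfl, show Nat.choose 7 9 = 0 from rfl, show Nat.choose 6 9 = 0 from rfl, show Nat.choose 5 9 = 0 from rfl, show Nat.choose 4 9 = 0 from rfl, show Nat.choose 3 9 = 0 from rfl, show Nat.choose 2 9 = 0 from rfl, show Nat.choose 1 9 = 0 from rfl]
      push_cast
      linear_combination (0 : K) * hp

end Char19Deg10

/-- `CA_10` FAILS over every field of characteristic `19`. [folklore] -/
theorem not_holdsInDegree_ten_of_char_19 [CharP K 19] : ¬ HoldsInDegree K 10 := by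
  have hq : (19 : K) = 0 := by simpa using CharP.cast_eq_zero K 19
  exact not_holdsInDegree_ten_of_nf10 K (isCasasAlvero_nf10_char_19 K)
    (fun h => one_ne_zero (by linear_combination (7 : K) * h - (4 : K) * hq : (1 : K) = 0))

end Literature.Algebra.Polynomial.CasasAlvero
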